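import Summits.QuantumFields.YangMills.Theorems.LuscherReductionRunningReductionLatticeLinkKernel
import Summits.QuantumFields.YangMills.Theorems.LuscherReductionOneSiteLevelsVariational
import HarnessLib

/-!
# A POLYNOMIAL lower bound for the top zero-flux transfer value of `SU(2)` on `(ℤ/L)³`:
# `λ₀(β, L) ≥ e^{−βr²(8|P|+2|E|)} · ballVol(r)^{2|E|} · c_β^{|E|}` for every radius `r ≥ 0`
# (sub-stub C1c of the fixed-lattice programme COARSE(L₀) — route `LuscherReduction`, crux RED stmt-QuantumFields-19978 KT-door 3b′ /
# crux `TwistedTraceScaling` stmt-QuantumFields-20203 S-BASE; card `pub/ym-fleet/ym-luscher-20007-p1/Lines-base-coarse-cut.md`)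

Companion of the large-field suppression `qform_le_exp_neg_of_action_ge_lat` (`…RunningReductionLatticeLargeField.lean`): that bound says a
physical test function living where `S ≥ η` has Rayleigh quotient `≤ e^{−βη} c_β^{|E|}`; to conclude that such functions cannot carry a low
level one needs `λ₀` itself to be within a POLYNOMIAL factor of the free row sum `c_β^{|E|} = latCE L β`.  This file proves it with the
constant trial function restricted (inside the integral) to the Hilbert–Schmidt box `A_r = {U | ∀e, ‖U_e − 1‖_F ≤ r}`:

* §1 near-identity algebra: `‖U_p − 1‖_F ≤ Σ_{e∈p} ‖U_e − 1‖_F` for a plaquette holonomy (unitary invariance of the Frobenius norm), hence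
  `2 − Re tr U_p ≤ 8r²` and `S(U) ≤ 8r²|P|` on `A_r`; and `w_β(U_eV_e⁻¹) ≥ e^{β(2−2r²)}` for `U, V ∈ A_r`;
* §2 `Haar^{⊗E}(A_r) = ballVol(r)^{|E|}` (product measure of a box);
* §3 ★ `levelValue_zero_ge_box`: `e^{−βr²(8|P|+2|E|)} · ballVol(r)^{2|E|} · latCE L β ≤ levelValue su2Rep L β 0` (`β ≥ 0`, any `r`), from
  `λ₀ ≥ ⟨1,K_β1⟩ ≥ ∫∫_{A_r×A_r} K_β` and `c_β ≤ e^{2β}`;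
* §4 the Haar volume of small balls is polynomial: `ballVol_ge_of_halving` (`√8 ≤ 2ⁿ r ⇒ ballVol r ≥ 5^{−8n}`, from the tree's doubling
  inequality `ballVol (2r) ≤ 5⁸ ballVol r` and `‖W − 1‖_F² ≤ 8`), so that with `r² = 1/β` the prefactor in §3 is `≥ C_L β^{−N_L}`:
  `levelValue_zero_ge_poly` (`β ≥ 1`: `e^{−(8|P|+2|E|)} · (5⁸(8β+1)¹⁹)^{−2|E|} · latCE ≤ λ₀`).

Consequence for COARSE (not formalised here): with `η = A log β/β` and `A > 19·2|E|·…`, large fields are negligible against every level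
`λ_k ≥ e^{−(Δ_k+1)u} λ₀`.  HONEST FRAMING: crude polynomial bookkeeping on `SU(2)^{3L³}`; no semiclassics; femto rung R2b1; not a gap, not Clay.
-/

set_option autoImplicit false

noncomputable section

open MeasureTheory Filter Topology Real
open scoped Matrix ComplexConjugate BigOperators Matrix.Norms.Frobenius
open Literature.MathematicalPhysics.QuantumFieldTheory
open Literature.MathematicalPhysics.QuantumLattice

namespace Summit.QuantumFields.YangMills.Theorems.FemtoTransferGap

variable {L : ℕ} [NeZero L]

/-! ## §1 Near-identity algebra on `SU(2)` -/

/-- `‖XY − 1‖_F ≤ ‖X − 1‖_F + ‖Y − 1‖_F` on `SU(2)` (`XY − 1 = X(Y − 1) + (X − 1)`, left unitary invariance). [cite: HornJohnson2013, Thm 2.2.2] -/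
theorem frobNorm_mul_sub_one_le (X Y : SU2) :
    frobNorm (((X * Y : SU2) : Matrix (Fin 2) (Fin 2) ℂ) - 1) ≤
      frobNorm ((X : Matrix (Fin 2) (Fin 2) ℂ) - 1) + frobNorm ((Y : Matrix (Fin 2) (Fin 2) ℂ) - 1) := by
  have e : ((X * Y : SU2) : Matrix (Fin 2) (Fin 2) ℂ) - 1 =
      (X : Matrix (Fin 2) (Fin 2) ℂ) * ((Y : Matrix (Fin 2) (Fin 2) ℂ) - 1) + ((X : Matrix (Fin 2) (Fin 2) ℂ) - 1) := by
    rw [Submonoid.coe_mul, Matrix.mul_sub, Matrix.mul_one]; abel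
  rw [e]
  calc frobNorm ((X : Matrix (Fin 2) (Fin 2) ℂ) * ((Y : Matrix (Fin 2) (Fin 2) ℂ) - 1) + ((X : Matrix (Fin 2) (Fin 2) ℂ) - 1))
      ≤ frobNorm ((X : Matrix (Fin 2) (Fin 2) ℂ) * ((Y : Matrix (Fin 2) (Fin 2) ℂ) - 1)) + frobNorm ((X : Matrix (Fin 2) (Fin 2) ℂ) - 1) := by
        rw [frobNorm_eq_norm, frobNorm_eq_norm, frobNorm_eq_norm]; exact norm_add_le _ _
    _ = frobNorm ((Y : Matrix (Fin 2) (Fin 2) ℂ) - 1) + frobNorm ((X : Matrix (Fin 2) (Fin 2) ℂ) - 1) := by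
        rw [frobNorm_unitary_mul (su2_mem_unitaryGroup X)]
    _ = frobNorm ((X : Matrix (Fin 2) (Fin 2) ℂ) - 1) + frobNorm ((Y : Matrix (Fin 2) (Fin 2) ℂ) - 1) := add_comm _ _

/-- `‖X⁻¹ − 1‖_F = ‖X − 1‖_F` on `SU(2)`. [folklore] -/
theorem frobNorm_inv_sub_one (X : SU2) :
    frobNorm (((X⁻¹ : SU2) : Matrix (Fin 2) (Fin 2) ℂ) - 1) = frobNorm ((X : Matrix (Fin 2) (Fin 2) ℂ) - 1) := by
  have h := frobNorm_sub_eq_mul_inv 1 X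
  rw [one_mul] at h
  rw [← h, show ((1 : SU2) : Matrix (Fin 2) (Fin 2) ℂ) - (X : Matrix (Fin 2) (Fin 2) ℂ) = -((X : Matrix (Fin 2) (Fin 2) ℂ) - 1) by
    rw [OneMemClass.coe_one]; abel, frobNorm_neg]

omit [NeZero L] in
/-- A plaquette holonomy is within `Σ_{e∈p} ‖U_e − 1‖_F ≤ 4r` of `1` when every link is within `r` of `1`. [folklore] -/
theorem frobNorm_plaquetteHolonomy_sub_one_le (U : GaugeConfig 3 L SU2) {r : ℝ}
    (hr : ∀ e, frobNorm ((U e : Matrix (Fin 2) (Fin 2) ℂ) - 1) ≤ r) (x : Site 3 L) (i j : Fin 3) :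
    frobNorm (((plaquetteHolonomy U x i j : SU2) : Matrix (Fin 2) (Fin 2) ℂ) - 1) ≤ 4 * r := by
  unfold plaquetteHolonomy
  have h1 := frobNorm_mul_sub_one_le (U (x, i) * U (x.shift i, j) * (U (x.shift j, i))⁻¹) (U (x, j))⁻¹
  have h2 := frobNorm_mul_sub_one_le (U (x, i) * U (x.shift i, j)) (U (x.shift j, i))⁻¹
  have h3 := frobNorm_mul_sub_one_le (U (x, i)) (U (x.shift i, j))
  rw [frobNorm_inv_sub_one] at h1 h2
  linarith [hr (x, i), hr (x.shift i, j), hr (x.shift j, i), hr (x, j)]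

omit [NeZero L] in
/-- One plaquette term is `≤ 8r²` on the box `A_r`. [folklore] -/
theorem plaquetteTerm_le_of_near_one (U : GaugeConfig 3 L SU2) {r : ℝ}
    (hr : ∀ e, frobNorm ((U e : Matrix (Fin 2) (Fin 2) ℂ) - 1) ≤ r) (x : Site 3 L) (i j : Fin 3) :
    2 - ((su2Rep (plaquetteHolonomy U x i j)).trace).re ≤ 8 * r ^ 2 := by
  rw [fundamentalRep_apply, two_sub_re_trace_eq]
  have h := frobNorm_plaquetteHolonomy_sub_one_le U hr x i j
  have h0 : 0 ≤ frobNorm (((plaquetteHolonomy U x i j : SU2) : Matrix (Fin 2) (Fin 2) ℂ) - 1) := frobNorm_nonneg _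
  have hsq := mul_le_mul h h h0 (by linarith)
  nlinarith

/-- **The magnetic energy is small on the box**: `S(U) ≤ 8r²·|P|` when every link is within `r` of `1`. [folklore] -/
theorem wilsonAction_le_of_near_one (U : GaugeConfig 3 L SU2) {r : ℝ}
    (hr : ∀ e, frobNorm ((U e : Matrix (Fin 2) (Fin 2) ℂ) - 1) ≤ r) :
    wilsonAction su2Rep U ≤ 8 * r ^ 2 * Fintype.card (Plaquette 3 L) := by
  have h1 : wilsonAction su2Rep U = ∑ p : Plaquette 3 L, (2 - ((su2Rep (plaquetteHolonomy U p.1 p.2.1.1 p.2.1.2)).trace).re) := by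
    unfold wilsonAction; simp
  rw [h1]
  calc ∑ p : Plaquette 3 L, (2 - ((su2Rep (plaquetteHolonomy U p.1 p.2.1.1 p.2.1.2)).trace).re)
      ≤ ∑ _p : Plaquette 3 L, (8 * r ^ 2 : ℝ) := Finset.sum_le_sum fun p _ => plaquetteTerm_le_of_near_one U hr _ _ _
    _ = 8 * r ^ 2 * Fintype.card (Plaquette 3 L) := by
        rw [Finset.sum_const, Finset.card_univ, nsmul_eq_mul]; ring

/-- On the box, every one-link weight of the electric factor is `≥ e^{β(2 − 2r²)}` (`‖U_eV_e⁻¹ − 1‖_F ≤ 2r`, `Re tr W = 2 − ‖W−1‖_F²/2`).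
[folklore] -/
theorem linkW_ge_of_near_one {β : ℝ} (hβ : 0 ≤ β) {r : ℝ} {u v : SU2}
    (hu : frobNorm ((u : Matrix (Fin 2) (Fin 2) ℂ) - 1) ≤ r) (hv : frobNorm ((v : Matrix (Fin 2) (Fin 2) ℂ) - 1) ≤ r) :
    Real.exp (β * (2 - 2 * r ^ 2)) ≤ linkW β (u * v⁻¹) := by
  unfold linkW
  refine Real.exp_le_exp.2 (mul_le_mul_of_nonneg_left ?_ hβ)
  have hd : frobNorm (((u * v⁻¹ : SU2) : Matrix (Fin 2) (Fin 2) ℂ) - 1) ≤ 2 * r := by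
    rw [← frobNorm_sub_eq_mul_inv]
    have e : (u : Matrix (Fin 2) (Fin 2) ℂ) - (v : Matrix (Fin 2) (Fin 2) ℂ) =
        ((u : Matrix (Fin 2) (Fin 2) ℂ) - 1) + -((v : Matrix (Fin 2) (Fin 2) ℂ) - 1) := by abel
    rw [e, frobNorm_eq_norm]
    calc ‖((u : Matrix (Fin 2) (Fin 2) ℂ) - 1) + -((v : Matrix (Fin 2) (Fin 2) ℂ) - 1)‖
        ≤ ‖(u : Matrix (Fin 2) (Fin 2) ℂ) - 1‖ + ‖-((v : Matrix (Fin 2) (Fin 2) ℂ) - 1)‖ := norm_add_le _ _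
      _ = frobNorm ((u : Matrix (Fin 2) (Fin 2) ℂ) - 1) + frobNorm ((v : Matrix (Fin 2) (Fin 2) ℂ) - 1) := by
          rw [norm_neg, frobNorm_eq_norm, frobNorm_eq_norm]
      _ ≤ 2 * r := by linarith
  have h0 : 0 ≤ frobNorm (((u * v⁻¹ : SU2) : Matrix (Fin 2) (Fin 2) ℂ) - 1) := frobNorm_nonneg _
  have htr := two_sub_re_trace_eq (u * v⁻¹)
  have hsq := mul_le_mul hd hd h0 (by linarith)
  nlinarith

/-- On `A_r × A_r` the electric factor is `≥ e^{β(2−2r²)|E|}`. [folklore] -/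
theorem latE_ge_of_near_one {β : ℝ} (hβ : 0 ≤ β) {r : ℝ} {U V : GaugeConfig 3 L SU2}
    (hU : ∀ e, frobNorm ((U e : Matrix (Fin 2) (Fin 2) ℂ) - 1) ≤ r) (hV : ∀ e, frobNorm ((V e : Matrix (Fin 2) (Fin 2) ℂ) - 1) ≤ r) :
    Real.exp (β * (2 - 2 * r ^ 2)) ^ Fintype.card (Edge 3 L) ≤ latE L β U V := by
  unfold latE
  rw [← Finset.card_univ, ← Finset.prod_const]
  exact Finset.prod_le_prod (fun e _ => (Real.exp_pos _).le) fun e _ => linkW_ge_of_near_one hβ (hU e) (hV e)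

/-- On `A_r × A_r` the transfer kernel is `≥ e^{−β·8r²|P|} · e^{β(2−2r²)|E|}`. [folklore] -/
theorem transferKernel_ge_of_near_one {β : ℝ} (hβ : 0 ≤ β) {r : ℝ} {U V : GaugeConfig 3 L SU2}
    (hU : ∀ e, frobNorm ((U e : Matrix (Fin 2) (Fin 2) ℂ) - 1) ≤ r) (hV : ∀ e, frobNorm ((V e : Matrix (Fin 2) (Fin 2) ℂ) - 1) ≤ r) :
    Real.exp (-(β * (8 * r ^ 2 * Fintype.card (Plaquette 3 L)))) * Real.exp (β * (2 - 2 * r ^ 2)) ^ Fintype.card (Edge 3 L) ≤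
      transferKernel su2Rep β U V :=
  (mul_le_mul_of_nonneg_left (latE_ge_of_near_one hβ hU hV) (Real.exp_pos _).le).trans
    (exp_mul_latE_le_transferKernel hβ (wilsonAction_le_of_near_one U hU) (wilsonAction_le_of_near_one V hV))

/-! ## §2 The Hilbert–Schmidt box and its Haar measure -/

/-- The one-link ball `{W | ‖W − 1‖_F ≤ r}` is measurable (closed). [folklore] -/
theorem measurableSet_frobBall_one (r : ℝ) : MeasurableSet {W : SU2 | frobNorm ((W : Matrix (Fin 2) (Fin 2) ℂ) - 1) ≤ r} :=
  (isClosed_le (continuous_frobNorm'.comp (continuous_subtype_val.sub continuous_const)) continuous_const).measurableSet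

omit [NeZero L] in
/-- The box `A_r` is the product of one-link balls. [folklore] -/
theorem box_eq_pi (r : ℝ) :
    {U : GaugeConfig 3 L SU2 | ∀ e, frobNorm ((U e : Matrix (Fin 2) (Fin 2) ℂ) - 1) ≤ r} =
      Set.pi Set.univ fun _ : Edge 3 L => {W : SU2 | frobNorm ((W : Matrix (Fin 2) (Fin 2) ℂ) - 1) ≤ r} := by
  ext U; simp

/-- The box `A_r` is measurable. [folklore] -/
theorem measurableSet_box (r : ℝ) :
    MeasurableSet {U : GaugeConfig 3 L SU2 | ∀ e, frobNorm ((U e : Matrix (Fin 2) (Fin 2) ℂ) - 1) ≤ r} := by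
  rw [box_eq_pi]
  exact MeasurableSet.univ_pi fun _ => measurableSet_frobBall_one r

/-- **`Haar^{⊗E}(A_r) = ballVol(r)^{|E|}`.** [folklore] -/
theorem configMeasure_real_box (r : ℝ) :
    (configMeasure SU2 L).real {U : GaugeConfig 3 L SU2 | ∀ e, frobNorm ((U e : Matrix (Fin 2) (Fin 2) ℂ) - 1) ≤ r} =
      ballVol r ^ Fintype.card (Edge 3 L) := by
  rw [box_eq_pi, Measure.real, configMeasure, Measure.pi_pi, ENNReal.toReal_prod, Finset.prod_const, Finset.card_univ]
  rfl

/-! ## §3 The box trial bound for `λ₀` -/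

/-- ★ **Box lower bound for the top value**: for every `β ≥ 0` and `r ≥ 0`,
`e^{−βr²(8|P|+2|E|)} · ballVol(r)^{2|E|} · c_β^{|E|} ≤ λ₀(β, L)` for every real `r` (`λ₀ ≥ ⟨1,K_β 1⟩ ≥ ∫∫_{A_r×A_r} K_β`, the kernel bound of §1 on the box,
`Haar^{⊗E}(A_r) = ballVol(r)^{|E|}`, and `c_β ≤ e^{2β}`). [folklore] -/
theorem levelValue_zero_ge_box {β : ℝ} (hβ : 0 ≤ β) (r : ℝ) :
    Real.exp (-(β * r ^ 2 * (8 * Fintype.card (Plaquette 3 L) + 2 * Fintype.card (Edge 3 L)))) *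
        ballVol r ^ (2 * Fintype.card (Edge 3 L)) * latCE L β ≤ levelValue su2Rep L β 0 := by
  set A : Set (GaugeConfig 3 L SU2) := {U | ∀ e, frobNorm ((U e : Matrix (Fin 2) (Fin 2) ℂ) - 1) ≤ r} with hA
  have hAm : MeasurableSet A := measurableSet_box r
  set m : ℝ := Real.exp (-(β * (8 * r ^ 2 * Fintype.card (Plaquette 3 L)))) *
    Real.exp (β * (2 - 2 * r ^ 2)) ^ Fintype.card (Edge 3 L) with hm
  have hm0 : 0 ≤ m := by positivity
  -- the constant trial function
  have h1 : IsPhys (G := SU2) (L := L) (fun _ => (1 : ℝ)) := isPhys_const 1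
  have hl2 : l2 (G := SU2) (L := L) (fun _ => (1 : ℝ)) (fun _ => 1) = 1 := by simp [l2]
  have hq : qform su2Rep β (L := L) (fun _ => (1 : ℝ)) (fun _ => 1) ≤ levelValue su2Rep L β 0 := by
    have h := qform_le_levelValue_zero_mul su2Rep continuous_su2Rep β h1 (by rw [hl2]; exact one_pos)
    rwa [hl2, mul_one] at h
  -- `⟨1,K1⟩ ≥ ∫∫ m·1_{A×A}`
  have hprod : qform su2Rep β (L := L) (fun _ => (1 : ℝ)) (fun _ => 1) =
      ∫ p, transferKernel su2Rep β p.1 p.2 ∂(configMeasure SU2 L).prod (configMeasure SU2 L) := by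
    rw [qform_eq_integral_latProd hβ h1]; congr 1; funext p; ring
  have hF : Integrable (fun p : GaugeConfig 3 L SU2 × GaugeConfig 3 L SU2 => transferKernel su2Rep β p.1 p.2)
      ((configMeasure SU2 L).prod (configMeasure SU2 L)) :=
    integrable_latProd (measurable_transferKernel_lat β) (abs_transferKernel_le_lat hβ)
  have hAA : MeasurableSet (A ×ˢ A) := hAm.prod hAm
  have hind : ∫ p, (A ×ˢ A).indicator (fun _ => m) p ∂(configMeasure SU2 L).prod (configMeasure SU2 L) =
      m * ((configMeasure SU2 L).real A) ^ 2 := by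
    rw [integral_indicator_const _ hAA, smul_eq_mul, Measure.real, Measure.prod_prod, ENNReal.toReal_mul]
    rw [← Measure.real]; ring
  have hle : ∫ p, (A ×ˢ A).indicator (fun _ => m) p ∂(configMeasure SU2 L).prod (configMeasure SU2 L) ≤
      ∫ p, transferKernel su2Rep β p.1 p.2 ∂(configMeasure SU2 L).prod (configMeasure SU2 L) := by
    refine integral_mono ((integrable_const m).indicator hAA) hF fun p => ?_
    by_cases hp : p ∈ A ×ˢ A
    · rw [Set.indicator_of_mem hp]
      obtain ⟨hU, hV⟩ := Set.mem_prod.1 hp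
      exact transferKernel_ge_of_near_one hβ hU hV
    · rw [Set.indicator_of_notMem hp]
      exact (transferKernel_pos _ _ _ _).le
  rw [hind, configMeasure_real_box] at hle
  -- `c_β^{|E|} ≤ e^{2β|E|}` turns `e^{β(2−2r²)|E|}` into `e^{−2βr²|E|} c_β^{|E|}`
  have hCE : latCE L β ≤ Real.exp (2 * β) ^ Fintype.card (Edge 3 L) := latCE_le hβ
  have hCE0 : 0 < latCE L β := latCE_pos hβ
  have hkey : Real.exp (-(β * r ^ 2 * (8 * Fintype.card (Plaquette 3 L) + 2 * Fintype.card (Edge 3 L)))) * latCE L β ≤ m := by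
    rw [hm]
    have e1 : Real.exp (β * (2 - 2 * r ^ 2)) ^ Fintype.card (Edge 3 L) =
        Real.exp (-(β * r ^ 2 * (2 * Fintype.card (Edge 3 L)))) * Real.exp (2 * β) ^ Fintype.card (Edge 3 L) := by
      rw [← Real.exp_nat_mul, ← Real.exp_nat_mul, ← Real.exp_add]; congr 1; ring
    have e2 : Real.exp (-(β * r ^ 2 * (8 * Fintype.card (Plaquette 3 L) + 2 * Fintype.card (Edge 3 L)))) =
        Real.exp (-(β * (8 * r ^ 2 * Fintype.card (Plaquette 3 L)))) * Real.exp (-(β * r ^ 2 * (2 * Fintype.card (Edge 3 L)))) := by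
      rw [← Real.exp_add]; congr 1; ring
    rw [e1, e2, mul_assoc]
    exact mul_le_mul_of_nonneg_left (mul_le_mul_of_nonneg_left hCE (Real.exp_pos _).le) (Real.exp_pos _).le
  have hb0 : 0 ≤ ballVol r ^ (2 * Fintype.card (Edge 3 L)) := pow_nonneg (ballVol_nonneg r) _
  calc Real.exp (-(β * r ^ 2 * (8 * Fintype.card (Plaquette 3 L) + 2 * Fintype.card (Edge 3 L)))) *
        ballVol r ^ (2 * Fintype.card (Edge 3 L)) * latCE L β
      = (Real.exp (-(β * r ^ 2 * (8 * Fintype.card (Plaquette 3 L) + 2 * Fintype.card (Edge 3 L)))) * latCE L β) *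
          ballVol r ^ (2 * Fintype.card (Edge 3 L)) := by ring
    _ ≤ m * ballVol r ^ (2 * Fintype.card (Edge 3 L)) := mul_le_mul_of_nonneg_right hkey hb0
    _ = m * (ballVol r ^ Fintype.card (Edge 3 L)) ^ 2 := by rw [← pow_mul, mul_comm 2]
    _ ≤ qform su2Rep β (L := L) (fun _ => (1 : ℝ)) (fun _ => 1) := by rw [hprod]; exact hle
    _ ≤ levelValue su2Rep L β 0 := hq

/-! ## §4 Small Hilbert–Schmidt balls have polynomial Haar volume -/

/-- A ball of radius `≥ √8` is all of `SU(2)` (`‖W − 1‖_F² ≤ 8`), so its volume is `1`. [folklore] -/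
theorem ballVol_eq_one_of_ge {r : ℝ} (hr : Real.sqrt 8 ≤ r) : ballVol r = 1 := by
  unfold ballVol
  have h : {W : SU2 | frobNorm ((W : Matrix (Fin 2) (Fin 2) ℂ) - 1) ≤ r} = Set.univ := by
    refine Set.eq_univ_of_forall fun W => ?_
    simp only [Set.mem_setOf_eq]
    have h8 := frobNorm_sub_one_sq_le_eight W
    have h0 := frobNorm_nonneg ((W : Matrix (Fin 2) (Fin 2) ℂ) - 1)
    have : frobNorm ((W : Matrix (Fin 2) (Fin 2) ℂ) - 1) ≤ Real.sqrt 8 := by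
      rw [← Real.sqrt_sq h0]
      exact Real.sqrt_le_sqrt h8
    exact this.trans hr
  rw [h, probReal_univ]

/-- **Halving bound**: `√8 ≤ 2ⁿ·r ⇒ ballVol r ≥ 5^{−8n}` (doubling inequality of the tree, iterated). [folklore] -/
theorem ballVol_ge_of_halving (n : ℕ) : ∀ {r : ℝ}, 0 ≤ r → Real.sqrt 8 ≤ 2 ^ n * r → (((5 : ℝ) ^ 8) ^ n)⁻¹ ≤ ballVol r := by
  induction n with
  | zero =>
    intro r _ h
    rw [pow_zero, one_mul] at h
    rw [pow_zero, inv_one, ballVol_eq_one_of_ge h]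
  | succ n ih =>
    intro r hr h
    have h2 : Real.sqrt 8 ≤ 2 ^ n * (2 * r) := by rw [pow_succ] at h; linarith
    have ih' := ih (by linarith) h2
    have hd := ballVol_two_mul_le hr
    have h58 : (0 : ℝ) < (5 : ℝ) ^ 8 := by positivity
    rw [pow_succ, mul_inv]
    calc (((5 : ℝ) ^ 8) ^ n)⁻¹ * ((5 : ℝ) ^ 8)⁻¹ ≤ ballVol (2 * r) * ((5 : ℝ) ^ 8)⁻¹ :=
          mul_le_mul_of_nonneg_right ih' (inv_pos.2 h58).le
      _ ≤ ballVol r := by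
          rw [← div_eq_mul_inv, div_le_iff₀ h58]; linarith

/-- **Polynomial volume of the ball of radius `1/√β`**: `ballVol (1/√β) ≥ (5⁸ · (8β+1)¹⁹)⁻¹` for `β ≥ 1`
(`n = log₂⌈8β⌉ + 1` halvings; `5⁸ ≤ 2¹⁹`). [folklore] -/
theorem ballVol_inv_sqrt_ge {β : ℝ} (hβ : 1 ≤ β) : ((5 : ℝ) ^ 8 * (8 * β + 1) ^ 19)⁻¹ ≤ ballVol (1 / Real.sqrt β) := by
  have hβ0 : 0 < β := by linarith
  have hsβ : 0 < Real.sqrt β := Real.sqrt_pos.2 hβ0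
  set m : ℕ := ⌈8 * β⌉₊ with hm
  have hm1 : (8 * β : ℝ) ≤ m := Nat.le_ceil _
  have hm2 : (m : ℝ) < 8 * β + 1 := Nat.ceil_lt_add_one (by positivity)
  have hmpos : 0 < m := by
    have : (0 : ℝ) < m := lt_of_lt_of_le (by linarith) hm1
    exact_mod_cast this
  set n : ℕ := Nat.log 2 m + 1 with hn
  -- `2^n > m ≥ 8β ≥ √(8β)·1`, so `√8 ≤ 2^n / √β`
  have h2n : (m : ℝ) < (2 : ℝ) ^ n := by
    have := Nat.lt_pow_succ_log_self (b := 2) (by norm_num) m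
    rw [hn]; exact_mod_cast this
  have hhalving : Real.sqrt 8 ≤ 2 ^ n * (1 / Real.sqrt β) := by
    rw [mul_one_div, le_div_iff₀ hsβ, ← Real.sqrt_mul (by norm_num : (0 : ℝ) ≤ 8)]
    have h8β : Real.sqrt (8 * β) ≤ 8 * β := by
      rw [Real.sqrt_le_left (by positivity)]
      nlinarith
    linarith
  have hball := ballVol_ge_of_halving n (by positivity) hhalving
  refine le_trans ?_ hball
  -- `(5^8)^n = 5^8 · (5^8)^{log₂ m} ≤ 5^8 · (2^{log₂ m})^19 ≤ 5^8 · m^19 ≤ 5^8 (8β+1)^19`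
  have hpow : ((5 : ℝ) ^ 8) ^ n ≤ (5 : ℝ) ^ 8 * (8 * β + 1) ^ 19 := by
    rw [hn, pow_succ, mul_comm]
    refine mul_le_mul_of_nonneg_left ?_ (by positivity)
    have h1 : ((5 : ℝ) ^ 8) ^ Nat.log 2 m ≤ ((2 : ℝ) ^ 19) ^ Nat.log 2 m :=
      pow_le_pow_left₀ (by positivity) (by norm_num) _
    have h2 : ((2 : ℝ) ^ 19) ^ Nat.log 2 m = ((2 : ℝ) ^ Nat.log 2 m) ^ 19 := by rw [← pow_mul, ← pow_mul, mul_comm]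
    have h3 : ((2 : ℝ) ^ Nat.log 2 m) ≤ m := by
      have := Nat.pow_log_le_self 2 (Nat.pos_iff_ne_zero.1 hmpos)
      exact_mod_cast this
    have h4 : ((2 : ℝ) ^ Nat.log 2 m) ^ 19 ≤ (m : ℝ) ^ 19 := pow_le_pow_left₀ (by positivity) h3 19
    have h5 : (m : ℝ) ^ 19 ≤ (8 * β + 1) ^ 19 := pow_le_pow_left₀ (by positivity) hm2.le 19
    linarith [h1, h2 ▸ h4]
  have hpos : (0 : ℝ) < ((5 : ℝ) ^ 8) ^ n := by positivity
  exact inv_anti₀ hpos hpow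

/-- ★ **Polynomial lower bound for the top value**: for `β ≥ 1`,
`e^{−(8|P|+2|E|)} · (5⁸(8β+1)¹⁹)^{−2|E|} · c_β^{|E|} ≤ λ₀(β, L)` — the top zero-flux transfer value of the `L³` torus is within a polynomial
factor (degree `38|E| = 114L³`) of the free row sum; with `qform_le_exp_neg_of_action_ge_lat`, magnetic energies `S ≥ A·log β/β` with
`A > 38|E|` are therefore negligible against `λ₀`. [cite: Luscher1983, §2] [cite: Balaban1989LargeFieldII, p.355] -/
theorem levelValue_zero_ge_poly {β : ℝ} (hβ : 1 ≤ β) :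
    Real.exp (-(8 * (Fintype.card (Plaquette 3 L) : ℝ) + 2 * Fintype.card (Edge 3 L))) *
        (((5 : ℝ) ^ 8 * (8 * β + 1) ^ 19)⁻¹) ^ (2 * Fintype.card (Edge 3 L)) * latCE L β ≤ levelValue su2Rep L β 0 := by
  have hβ0 : 0 < β := by linarith
  have hbox := levelValue_zero_ge_box (L := L) hβ0.le (1 / Real.sqrt β)
  have hr2 : β * (1 / Real.sqrt β) ^ 2 = 1 := by
    rw [div_pow, one_pow, Real.sq_sqrt hβ0.le]; field_simp
  have e1 : -(β * (1 / Real.sqrt β) ^ 2 * (8 * (Fintype.card (Plaquette 3 L) : ℝ) + 2 * Fintype.card (Edge 3 L))) =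
      -(8 * (Fintype.card (Plaquette 3 L) : ℝ) + 2 * Fintype.card (Edge 3 L)) := by
    rw [hr2, one_mul]
  rw [e1] at hbox
  refine le_trans ?_ hbox
  have hCE0 : 0 ≤ latCE L β := (latCE_pos hβ0.le).le
  refine mul_le_mul_of_nonneg_right (mul_le_mul_of_nonneg_left ?_ (Real.exp_pos _).le) hCE0
  exact pow_le_pow_left₀ (by positivity) (ballVol_inv_sqrt_ge hβ) _

end Summit.QuantumFields.YangMills.Theorems.FemtoTransferGap

end
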